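import Summits.QuantumFields.YangMills.Theorems.BalabanUVNodesN06AtRecord11ObligationsSectB
import Literature.MathematicalPhysics.QuantumFieldTheory.Balaban1983to89.B9SectBStepFrameV5

/-!
# BalabanUVNodes ∕ N06 ([B9], `Dag.B9_main`) — THE SECT.-B OBLIGATION `hB` OF THE STAGE-11 CERTIFICATE AT THE RECORD FROM ONE
# LETTERS DICTIONARY `SectBFrame₅` (row 13 in one instantiation, FRAMES V5 — ALL TWELVE (3.46) member-steps of Sect. B (six for G′(U′U), six for
# G(U′U)) framed kernel-free by the ℓ²-block route; only the three Hölder ∕ sup steps (3.43)–(3.45) of G(U′U) still displayed, plus ONE printed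
# inequality ((3.77) in block-ℓ²) inside the frame)

Track A of `YM-PLAN.md` (cell `pub-ymgap`, HUMAN RULING D-0062), node **N06** = [Balaban1985BackgroundPropagators] Thms 3.1–3.15;
seat `pub-ymgap-dag-n06-c` gen 6 (N06-ASSIGNMENT row 13 `hB`).  The v5 twin of `BalabanUVNodesN06SectBOfFrameV4` (p514352): same conclusion,
binder `F : B9SectBStepFrameV5.SectBFrame₅ …` — `SectBFrame₄`'s ten kernel-free steps and six G′ `L²` member-steps plus the bond-sector `L²`
dictionary `B9SectBL2GStepAtLettersV2.L2GFrame₂` (the six (3.46) members of G(U′U) on print's route p. 407, via `B9Thm34GL2Entries`), with three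
positive-input block-steps still displayed ((3.43)–(3.45) of G(U′U), Theorem 3.3's operator) and one printed inequality ((3.77) for the concrete
`P₁(A)` in block-ℓ²) displayed inside `L2GFrame₂`.

WHAT THIS MODULE DOES (kernel bookkeeping BY NAME; 0 `def`, 0 `sorry`, standard axioms; COUNT-NEUTRAL, `--supports` K1⁗ as helper):
* `hB_obligation_of_sectBFrame₅` — `hB` AT THE RECORD from ONE `F : SectBFrame₅ …` over the layer's families with `F.dB = θ₃.d₆ + 1`, and the
  leaf's Theorems 3.2 ∕ 3.3; the sign schema DISCHARGED by dag-n03-b's `modelSignsOn_geo9K`.  Drop-in replacement for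
  `N06SectBOfFrameV4.hB_obligation_of_sectBFrame₄`.

HONEST FRAMING.  `F` is a HYPOTHESIS: no `SectBFrame₅` over the record's operator layer exists in the tree yet; its displayed step fields are Sect.-B
CONTENT of [B9] for those members (Theorem 3.3 × Theorem 3.4, p. 407), not in the tree; N06 is NOT discharged.  One finite four-torus programme at
fixed `ε` — NOT ℝ⁴, NOT OS, NOT a mass gap, NOT Clay.  No `def`.
-/

noncomputable section

namespace Summit.QuantumFields.YangMills.BalabanUVNodes.N06SectBOfFrameV5

open Literature.MathematicalPhysics.QuantumFieldTheory.Balaban1983to89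
open Literature.MathematicalPhysics.QuantumFieldTheory.Balaban1983to89.Node00
open Literature.MathematicalPhysics.QuantumFieldTheory.Balaban1983to89.B9PinMembersKLevelV1 (MemberY geo9Y bg9Y)
open Literature.MathematicalPhysics.QuantumFieldTheory.Balaban1983to89.B9PinGeometryKLevelV1 (c35Y)
open Literature.MathematicalPhysics.QuantumFieldTheory.Balaban1983to89.B7Prop2SpecialUnitary (specialUnitaryUnits)
open Literature.MathematicalPhysics.QuantumFieldTheory.Balaban1983to89.B9GeoNormsKLevelModelSignsV1 (modelSignsOn_geo9K)
open Literature.MathematicalPhysics.QuantumFieldTheory.Balaban1983to89.B9SectBStepFrameV5 (SectBFrame₅ sectBStepPrinted_of_sectBFrame₅)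
open scoped Matrix.Norms.L2Operator

variable {N : ℕ}

/-- **THE `hB` OBLIGATION OF THE CERTIFICATE AT THE RECORD'S [B9] BUNDLE FROM ONE SECT.-B LETTERS DICTIONARY (V5)** (Sect. B pp. 400–407;
Theorem 3.4 p. 400; p. 403 l. 1–9; p. 407): given a `SectBFrame₅` (all twelve `L²` member-steps of (3.46) theorems on the letters) over the layer's
kernel families whose dimension field is the record's `θ₃.d₆ + 1`, and the leaf's Theorems 3.2 ∕ 3.3, the Sect.-B obligation `hB` holds — `B9SectBStepFrameV5.sectBStepPrinted_of_sectBFrame₅` with the sign schema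
`modelSignsOn_geo9K x.toKIdx`.  `F` is a hypothesis; nothing of print asserted.
[cite: Balaban1985BackgroundPropagators, Thm 3.4 p.400 + Sect. B (3.50)–(3.86) pp.400–407 + Thms 3.1–3.3 pp.397–399 + (3.39)–(3.41) p.397] -/
theorem hB_obligation_of_sectBFrame₅ (θ₃ : Stage3Params) (Mstar : ℕ) (ops : OpsY N θ₃ Mstar)
    [∀ x : MemberY θ₃.d₆ θ₃.ℓ₆ θ₃.hd' θ₃.hL' θ₃.b₀ θ₃.b₁ Mstar, Fintype (geo9Y x).Site]
    [∀ x : MemberY θ₃.d₆ θ₃.ℓ₆ θ₃.hd' θ₃.hL' θ₃.b₀ θ₃.b₁ Mstar, DecidableEq (geo9Y x).Site]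
    [∀ x : MemberY θ₃.d₆ θ₃.ℓ₆ θ₃.hd' θ₃.hL' θ₃.b₀ θ₃.b₁ Mstar, Nonempty (geo9Y x).Site]
    {ι κ : Type} [Fintype ι] [DecidableEq ι] [Fintype κ] [LinearOrder κ] (b : Module.Basis ι ℝ (Matrix (Fin N) (Fin N) ℂ))
    (S : MemberY θ₃.d₆ θ₃.ℓ₆ θ₃.hd' θ₃.hL' θ₃.b₀ θ₃.b₁ Mstar → Type) [∀ x, Fintype (S x)] [∀ x, DecidableEq (S x)]
    (F : SectBFrame₅ c35Y geo9Y (bg9Y (Matrix (Fin N) (Fin N) ℂ) (specialUnitaryUnits (Fin N))) (fun x => (ops x).Gp) b κ S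
      (fun x => (ops x).GA) (fun x => (ops x).Cinv) (fun x => (ops x).IsAnalyticExt))
    (hd : F.dB = θ₃.d₆ + 1)
    (h32 : B9.Thm32Printed (θ₃.d₆ + 1) c35Y geo9Y (bg9Y (Matrix (Fin N) (Fin N) ℂ) (specialUnitaryUnits (Fin N))) (fun x => (ops x).Cinv))
    (h33 : B9.Thm33Printed c35Y geo9Y (bg9Y (Matrix (Fin N) (Fin N) ℂ) (specialUnitaryUnits (Fin N))) (fun x => (ops x).Gp)
      (fun x => (ops x).GA)) :
    B9.SectBStepPrinted (θ₃.d₆ + 1) c35Y geo9Y (bg9Y (Matrix (Fin N) (Fin N) ℂ) (specialUnitaryUnits (Fin N))) (fun x => (ops x).Gp)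
      (fun x => (ops x).GA) (fun x => (ops x).Cinv) (fun x => (ops x).IsAnalyticExt) := by
  rw [← hd] at h32 ⊢
  exact sectBStepPrinted_of_sectBFrame₅ F (P := fun _ lam => lam.isRight = true) (fun x => modelSignsOn_geo9K x.toKIdx) h32 h33

end Summit.QuantumFields.YangMills.BalabanUVNodes.N06SectBOfFrameV5
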